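import Mathlib
import Summits.Ventures.PercRepro.TriangleCapTFamily

/-!
# PercRepro — THE ONE-TRIANGLE FAMILY `T` OF THE STABILITY TABLE ON EVERY ROW: `K_{a,n−a}` minus an `r`-star with
a vertex hung on an edge is a `K₄⁻`-free graph on the cell `(n + 1, a, r + a − 2)` exactly
`2 (n − 2a) + 2r (a − 3)` below the closed form, and it is a spanning subgraph of no `K(A, Aᶜ)` (p3, gen 45;
part 198c)

`tFamilyGen n a r` on `Fin (n + 1)` (`k = n + 1`) is `hangEdge (bipMinusStar n a r) 1 (n − 1)`: the complete
bipartite graph `K_{a,n−a}` with parts `{0, …, a − 1}` and `{a, …, n − 1}`, minus the star of `r` pairs at the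
small-side vertex `0`, plus the vertex `n` hung on the edge `{1, n − 1}` (`1` is not the star centre, `n − 1` is
off the star since `n ≥ a + r + 1`). The row `a = 3` is part 189's `tFamily n (r + 1)`; the row `a = 4` at `r = 0`
is the family of the cell `(k, 4, 2)`. In the coordinates of the cell `(k, a, r′)`, `r′ = r + a − 2`, the gap is
`T = 2k − 14 − 2 (a − 3)(a − r′)` — the family `T` of §10bt(e). Axioms: standard.
-/

namespace PercRepro

namespace TriangleCap

namespace C047

open Finset

/-- The one-triangle family on the cell `(n + 1, a, r + a − 2)`: `K_{a,n−a}` minus an `r`-star at `0`, with the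
vertex `n` hung on the edge `{1, n − 1}`. -/
abbrev tFamilyGen (n a r : ℕ) (hn : 2 ≤ n) : SimpleGraph (Fin (n + 1)) :=
  hangEdge (bipMinusStar n a r) ⟨1, by omega⟩ ⟨n - 1, by omega⟩

/-- The edge `{1, n − 1}` of `bipMinusStar n a r` (`2 ≤ a`, `a + r + 1 ≤ n`). -/
theorem bipMinusStar_adj_one_last_row (n a r : ℕ) (ha : 2 ≤ a) (hn : a + r + 1 ≤ n) :
    (bipMinusStar n a r).Adj ⟨1, by omega⟩ ⟨n - 1, by omega⟩ := by
  rw [bipMinusStar_adj]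
  simp only
  refine ⟨?_, ?_⟩
  · exact Or.inl ⟨by omega, by omega⟩
  · omega

/-- `1` and `n − 1` have no common neighbour in `bipMinusStar n a r` (it is bipartite, `2 ≤ a`, `a + 1 ≤ n`). -/
theorem bipMinusStar_no_common_row (n a r : ℕ) (ha : 2 ≤ a) (hn : a + 1 ≤ n) (w : Fin n) :
    ¬ ((bipMinusStar n a r).Adj ⟨1, by omega⟩ w ∧ (bipMinusStar n a r).Adj ⟨n - 1, by omega⟩ w) := by
  rintro ⟨h1, h2⟩
  have e1 := bipMinusStar_bipartite n a r _ _ h1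
  have e2 := bipMinusStar_bipartite n a r _ _ h2
  simp only [mem_filter, mem_univ, true_and] at e1 e2
  omega

/-- The degree of `1` in `bipMinusStar n a r` is `n − a` (`2 ≤ a`, `a + r ≤ n`). -/
theorem deg_bipMinusStar_one_row (n a r : ℕ) (ha : 2 ≤ a) (hn : a + r ≤ n) :
    deg (bipMinusStar n a r) ⟨1, by omega⟩ = n - a := by
  rw [deg_bipMinusStar n a r (by omega) hn]
  simp only [rightStar, mem_filter, mem_univ, true_and]
  rw [if_neg (by omega), if_neg (by omega)]
  exact deg_bip_of_lt n a (by omega) _ (by simp only; omega)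

/-- The degree of `n − 1` in `bipMinusStar n a r` is `a` (`2 ≤ a`, `a + r + 1 ≤ n`). -/
theorem deg_bipMinusStar_last_row (n a r : ℕ) (ha : 2 ≤ a) (hn : a + r + 1 ≤ n) :
    deg (bipMinusStar n a r) ⟨n - 1, by omega⟩ = a := by
  rw [deg_bipMinusStar n a r (by omega) (by omega)]
  simp only [rightStar, mem_filter, mem_univ, true_and]
  rw [if_neg (by omega), if_neg (by omega)]
  exact deg_bip_of_not_lt n a (by omega) _ (by simp only; omega)

/-- The identity of the family: `E₀ + r = a (n − a)`, `S₀ + r (2n − r − 1) = a (n − a) n` ⇒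
`S₀ + 2n + 6 + (r + a − 2)(n − (r + a − 2)) + 2 (n − 2a) + 2r (a − 3) = (E₀ + 2)(n + 1)` (`3 ≤ a`, `a + r + 1 ≤ n`,
`2a ≤ n`). -/
theorem tFamilyGen_arith (n a r E₀ S₀ : ℕ) (ha : 3 ≤ a) (hn : a + r + 1 ≤ n) (h2a : 2 * a ≤ n)
    (hE : E₀ + r = a * (n - a)) (hS : S₀ + r * (2 * n - r - 1) = a * (n - a) * n) :
    S₀ + 2 * (n - a + a) + 6 + (r + a - 2) * (n + 1 - 1 - (r + a - 2)) + 2 * (n - 2 * a) + 2 * r * (a - 3) =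
      (E₀ + 2) * (n + 1) := by
  obtain ⟨a3, rfl⟩ : ∃ a3, a = a3 + 3 := ⟨a - 3, by omega⟩
  obtain ⟨c, rfl⟩ : ∃ c, n = 2 * (a3 + 3) + c := ⟨n - 2 * (a3 + 3), by omega⟩
  obtain ⟨s, hs⟩ : ∃ s, a3 + c + 2 = r + s := ⟨a3 + c + 2 - r, by omega⟩
  have e1 : 2 * (a3 + 3) + c - (a3 + 3) = a3 + 3 + c := by omega
  have e2 : 2 * (2 * (a3 + 3) + c) - r - 1 = 3 * a3 + c + 9 + s := by omega
  have e3 : r + (a3 + 3) - 2 = r + a3 + 1 := by omega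
  have e4 : 2 * (a3 + 3) + c + 1 - 1 - (r + a3 + 1) = s + 3 := by omega
  have e5 : 2 * (a3 + 3) + c - 2 * (a3 + 3) = c := by omega
  have e6 : a3 + 3 - 3 = a3 := by omega
  rw [e1] at hE hS
  rw [e2] at hS
  rw [e1, e3, e4, e5, e6]
  obtain rfl : r = a3 + c + 2 - s := by omega
  have hs' : s ≤ a3 + c + 2 := by omega
  obtain ⟨q, hq⟩ : ∃ q, a3 + c + 2 = s + q := ⟨a3 + c + 2 - s, by omega⟩
  have e7 : a3 + c + 2 - s = q := by omega
  rw [e7] at hE hS ⊢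
  have hcq : c = s + q - a3 - 2 := by omega
  nlinarith [hE, hS]

/-- **THE ONE-TRIANGLE FAMILY ON THE CELL `(n + 1, a, r + a − 2)`:** for `3 ≤ a`, `a + r + 1 ≤ n`, `2a ≤ n`:
`K₄⁻`-free, `a (n + 1 − a) − (r + a − 2)` edges, `Σ_v d(v)² + r′ (k − 1 − r′) + 2 (n − 2a) + 2r (a − 3) = m k`
(`k = n + 1`, `r′ = r + a − 2`), and a spanning subgraph of no `K(A, Aᶜ)`. -/
theorem tFamilyGen_value (n a r : ℕ) (ha : 3 ≤ a) (hn : a + r + 1 ≤ n) (h2a : 2 * a ≤ n) :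
    K4mFree (tFamilyGen n a r (by omega)) ∧
      (tFamilyGen n a r (by omega)).edgeFinset.card + (r + a - 2) = a * (n + 1 - a) ∧
      ∑ v, deg (tFamilyGen n a r (by omega)) v * deg (tFamilyGen n a r (by omega)) v +
          (r + a - 2) * (n + 1 - 1 - (r + a - 2)) + 2 * (n - 2 * a) + 2 * r * (a - 3) =
        (tFamilyGen n a r (by omega)).edgeFinset.card * (n + 1) ∧
      ∀ A : Finset (Fin (n + 1)), ¬ BipSub (tFamilyGen n a r (by omega)) A := by
  have hadj := bipMinusStar_adj_one_last_row n a r (by omega) hn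
  have hne : (⟨1, by omega⟩ : Fin n) ≠ ⟨n - 1, by omega⟩ := by
    intro h
    rw [Fin.ext_iff] at h
    simp only at h
    omega
  have hE := card_edges_bipMinusStar n a r (by omega) (by omega)
  have hS := (sums_bipMinusStar n a r (by omega) (by omega)).2
  have hd1 := deg_bipMinusStar_one_row n a r (by omega) (by omega)
  have hd2 := deg_bipMinusStar_last_row n a r (by omega) hn
  have hE' : (tFamilyGen n a r (by omega)).edgeFinset.card = (bipMinusStar n a r).edgeFinset.card + 2 :=
    card_edges_hangEdge (bipMinusStar n a r) hne
  have hS' : ∑ v, deg (tFamilyGen n a r (by omega)) v * deg (tFamilyGen n a r (by omega)) v =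
      ∑ v, deg (bipMinusStar n a r) v * deg (bipMinusStar n a r) v +
        2 * (deg (bipMinusStar n a r) ⟨1, by omega⟩ + deg (bipMinusStar n a r) ⟨n - 1, by omega⟩) + 6 :=
    sum_deg_sq_hangEdge (bipMinusStar n a r) hne
  rw [hd1, hd2] at hS'
  refine ⟨?_, ?_, ?_, ?_⟩
  · exact k4mFree_hangEdge _ (k4mFree_bipMinusStar n a r) hadj (bipMinusStar_no_common_row n a r (by omega) (by omega))
  · rw [hE']
    have e : a * (n + 1 - a) = a * (n - a) + a := by
      rw [← Nat.mul_succ]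
      congr 1
      omega
    omega
  · rw [hS', hE']
    exact tFamilyGen_arith n a r _ _ ha hn h2a hE hS
  · intro A
    exact not_bipSub_hangEdge _ hadj A

end C047

end TriangleCap

end PercRepro
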